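import Summits.Ventures.CertifiedManyBodySolver.Observables.NeelClassFloorTraces
import HarnessLib

/-!
# Ventures/CertifiedManyBodySolver — Observables/NeelClassKineticFloor.lean
# A kinetic-energy floor with a Néel (spin-density-wave) reference for the `t–t'` Hubbard model on the
# even square torus, and the energy floor of the Néel mean-field class (part 3 of 3; parts 1–2:
# `NeelClassFloorOneBody.lean`, `NeelClassFloorTraces.lean`)

HONEST FRAMING: first certified bounds; not a superconductivity verdict; every number certified or labelled float.
A competing-order EXCLUSION removes a named class of candidate ground states; it never says which order is present;
no phase sentence follows.

Cell `hubbard-tc` (MO-S3, D-0096), seat `hubbard-tc-mod-3` (G3: competing orders — stripe/CDW/AF — as EXCLUSION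
inputs from certified energy ORDERINGS), `prover-hubbard-tc-mod-3-g7-0`. The AF item of the seat's row: the KERNEL
device behind the G3 words «Néel (antiferromagnetic) mean-field class excluded» (`NeelClassExclusion*.lean`).
Family `hubbard`; namespace `Summit.Ventures.CertifiedManyBodySolver.Observables.NeelClassFloor`.
Continuation of `HartreeFockSDWTorus.lean` (the SDW one-body algebra `h_s = K + sΔS`, `h_s² = K² + Δ²`,
`R = (K² + Δ²)^{-1/2}`, the band projections `P_s = ½(1 - h_s R)`) and of
`HubbardTTPrimeFreeKineticBound.lean` (`H(t,t',0) = dΓ_↑(A_{tt'}) + dΓ_↓(A_{tt'})`, the Lieb–Loss bathtub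
on Fock space).

## The inequality

On `(ℤ/Lℤ)²`, `L ≥ 3` even, write `K = -tA_nn`, `K' = -t'A_diag` (`t' ≤ 0`), `S = diag((-1)^{x₁+x₂})`,
`E = √(K² + Δ²)` (a function of the torus hopping matrix, `E = (K² + Δ²)·R`), `N̂ = Σ_{xσ} n_{xσ}` and
`Ô = Σ_x (-1)^{x₁+x₂}(n_{x↑} - n_{x↓})` (twice the staggered magnetisation; `Ô = dΓ_↑(S) - dΓ_↓(S)`).
For every real `Δ ≠ 0` with `4|t'| ≤ |Δ|` and `|Δ|·|t'| ≤ 2(t² - t'²)` and EVERY Fock vector `φ`: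

  `Re⟨φ, H(t,t',0)φ⟩ ≥ -Δ·Re⟨φ, Ôφ⟩ + |Δ|(L²‖φ‖² - Re⟨φ, N̂φ⟩) - L²√(4t² + Δ²)‖φ‖²`
                                                        (`re_expect_hubbardTorusTT'_zero_ge_sdw`).

Proof (operator inequalities only, no eigenvalue count): per spin, `A_σ = h_{±} + K'` with the OPPOSITE
staggered fields `h_± = K ± ΔS`; since `E`, `K'`, `P_±` commute pairwise,
`A_σ = (E + K')(1 - P) - (E - K')P`; `(E + K')(1 - P) ⪰ 0`; `(E - K' - |Δ|)P ⪰ 0` because, momentum by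
momentum, `√(ε_k² + Δ²) ≥ |Δ| + ε'_k` for the hole-doped sign `t' ≤ 0` under the two side conditions
(`sdwE_sub_siteDiagBand_sub_abs_nonneg` — the top of the lower SDW band stays at `-|Δ|` when `t' ≤ 0`);
on Fock space `dΓ_σ(C) ⪰ 0` and `dΓ_σ(C) ≤ tr C` for `C ⪰ 0`, `dΓ_σ(P) ≤ N̂_σ` for `P ≤ 1`; the two
spins together fill both SDW bands once: `Σ_± tr(E P_±) = tr E`, `Σ_± tr(K' P_±) = 0`, `Σ_± tr P_± = L²`;
finally `tr E = Σ_k E_k ≤ L²√(4t² + Δ²)` (Cauchy–Schwarz and `Σ_k ε_k² = tr K² = 4t²L²`).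

## The Néel mean-field class

For `U ≥ 0`, a Fock vector with mean density `n` (`Re⟨N̂⟩ = nL²‖φ‖²`), staggered magnetisation `m`
(`Re⟨Ô⟩ = 2mL²‖φ‖²`) and AT LEAST THE HARTREE DOUBLE OCCUPANCY OF ITS OWN NÉEL ORDER,
`Re⟨D̂⟩ ≥ (n²/4 - m²)L²‖φ‖²` (`D̂ = Σ_x n_{x↑}n_{x↓}`) — every collinear two-sublattice (Néel) Hartree–Fock
state with uniform sublattice moments is such a vector (Wick: `⟨n_{x↑}n_{x↓}⟩ = (n/2)² - m²`), as is every
non-magnetic quasi-free / singlet-BCS state (`m = 0`) — obeys, for every admissible `δ > 0`,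

  `Re⟨φ, H(t,t',U)φ⟩ ≥ L²‖φ‖² · (2δ|m| + δ(1 - n) - √(4t² + δ²) + U(n²/4 - m²))`
                                                        (`re_expect_hubbardTorusTT'_ge_neelClass`).

This is the class FLOOR used by the cell's G3 words «Néel mean-field class excluded»: whenever the
right-hand side exceeds a certified CEILING on the ground-state energy density, no state of the class on
any even torus reaches the ground-state energy density (an energy ORDERING; it never says which order is
present). Everything here is PROVED; no definition, no named fact, no `sorry`.

## Mathlib / tree search

Tree (REUSED): `HartreeFock.conjDiag`, `conjDiag_mul`, `conjDiag_add`, `conjDiag_const`, `trace_conjDiag`,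
`posSemidef_conjDiag`, `hopMatrix_eq_conjDiag`, `trace_hopMatrix`, `stagMatrix`, `stagMatrix_mul_self`,
`conjTranspose_stagMatrix`, `stagMatrix_mul_hopMatrix_mul_stagMatrix`, `sdwE`, `sdwE_pos`, `sdwE_sq`, `sdwR`,
`sdwM`, `sdwM_eq_conjDiag`, `sdwR_mul_sdwR_mul_sdwM`, `stagMatrix_mul_sdwM_mul_stagMatrix`,
`stagMatrix_mul_sdwR_mul_stagMatrix`, `sdwH`, `conjTranspose_sdwH`, `sdwH_mul_sdwR`, `sdwProj`,
`conjTranspose_sdwProj`, `sdwProj_mul_self`, `trace_sdwProj_add` (`HartreeFockSDWTorus`);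
`TTPrimeFree.ttHopMatrix`, `hubbardTorusTT'_zero_eq_dGammaSpin`, `hubbardTorusTT'_eq_add_smul`,
`siteDiagBand`, `hopMatrix_diag_mul_sitePlaneWave` (`HubbardTTPrimeFreeKineticBound`); `TTPrimeFree.hopMatrix_diag_eq_conjDiag`
(`HubbardTTPrimeHartreeFockCeiling`);
`LangerMattis.dGammaSpin`, `dGammaSpin_add`, `dGammaSpin_smul`, `dGammaSpin_one`,
`re_rayleigh_dGammaSpin_eq_sum`, `sum_min_eigenvalues_mul_normSq_le`, `totalNumber_eq_add`
(`HubbardLangerMattisBound`); `normSq_annihilate_mulVec_le`, `spinMode_unit`;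
`torusStagger_eq_of_diagAdj` (`HubbardNNNHoppingParticleHole`); `card_filter_fermionTorusGraph_adj`
(`HubbardGroundStateLatticeCovariance`); `re_rayleigh_interaction_nonneg` (`HubbardFreeKineticLowerBound`).
Mathlib: `Matrix.PosSemidef.mul_mul_conjTranspose_same`, `Matrix.posSemidef_self_mul_conjTranspose`,
`Matrix.PosSemidef.eigenvalues_nonneg`, `Matrix.IsHermitian.trace_eq_sum_eigenvalues`,
`Finset.sum_mul_sq_le_sq_mul_sq`.
`lean search 'sdwProj|stagMatrix|Neel.*floor|staggered.*kinetic'`: no lower bound of this kind in the tree.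

## References

* E. H. Lieb, M. Loss, Duke Math. J. 71 (1993) 337, §8, Theorem 8.2 (sum of negative eigenvalues bounds
  `dΓ`; bathtub). [LiebLoss1993]
* J. S. Langer, D. C. Mattis, Phys. Lett. 36A (1971) 139, eqs. (2)–(3) (the two-sublattice one-body
  Hamiltonian `K ± ΔS`, bands `±√(ε² + Δ²)`). [LangerMattis1971]
* V. Bach, E. H. Lieb, J. P. Solovej, J. Stat. Phys. 76 (1994) 3, §2 eq. (2c.36) (quasi-free states: Wick's
  rule `⟨n↑n↓⟩ = ⟨n↑⟩⟨n↓⟩` for collinear Slater determinants). [BachLiebSolovej1994]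
* H. Xu et al., Science 384 (2024) eadh7691, eq. (1) (the `t–t'` Hubbard model, `t' < 0`). [XuEtAl2024]
-/

noncomputable section

namespace Summit.Ventures.CertifiedManyBodySolver.Observables

namespace NeelClassFloor

open Literature.MathematicalPhysics.QuantumLattice

open Matrix Finset Literature.Probability.LatticeModels
  Literature.MathematicalPhysics.QuantumLattice.RayleighBound
  Literature.MathematicalPhysics.QuantumLattice.HubbardBandBottom
  Literature.MathematicalPhysics.QuantumLattice.LangerMattis
  Literature.MathematicalPhysics.QuantumLattice.HartreeFock
  Literature.MathematicalPhysics.QuantumLattice.TTPrimeFree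
  Literature.MathematicalPhysics.QuantumLattice.FreeKinetic
open scoped ComplexOrder ComplexConjugate

variable {L : ℕ}

/-! ### §5 The kinetic floor with a Néel reference, and the Néel-class energy floor -/

section Main

variable [NeZero L]

/-- `dΓ_↑(K + K' + ΔS) + dΓ_↓(K + K' - ΔS) = H(t,t',0) + Δ(dΓ_↑(S) - dΓ_↓(S))`: the free `t–t'`
Hamiltonian plus a staggered field term, species by species. [cite: LangerMattis1971, eq. (2)] -/
theorem dGammaSpin_sdwH_add_diag_sum (t t' Δ : ℝ) :
    dGammaSpin 0 (sdwH 2 L (-t) Δ 1 + hopMatrix (fermionTorusDiagGraph L) (-t')) +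
        dGammaSpin 1 (sdwH 2 L (-t) Δ (-1) + hopMatrix (fermionTorusDiagGraph L) (-t')) =
      hubbardTorusTT' L t t' 0 +
        (Δ : ℂ) • (dGammaSpin 0 (stagMatrix 2 L) - dGammaSpin 1 (stagMatrix 2 L)) := by
  rw [hubbardTorusTT'_zero_eq_dGammaSpin, sdwH, sdwH, ttHopMatrix]
  simp only [dGammaSpin_add, dGammaSpin_smul, smul_sub]
  have h1 : (((1 : ℝ) * Δ : ℝ) : ℂ) = (Δ : ℂ) := by push_cast; ring
  have h2 : (((-1 : ℝ) * Δ : ℝ) : ℂ) = -(Δ : ℂ) := by push_cast; ring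
  rw [h1, h2, neg_smul]
  abel

/-- **The kinetic-energy floor with a Néel reference** (`t' ≤ 0`, the hole-doped sign). On `(ℤ/Lℤ)²`,
`L ≥ 3` even, for every real `Δ ≠ 0` with `4|t'| ≤ |Δ|`, `|Δ||t'| ≤ 2(t² - t'²)` and every Fock vector `φ`:
`-Δ Re⟨φ, Ôφ⟩ + |Δ|(L²‖φ‖² - Re⟨φ, N̂φ⟩) - L²√(4t² + Δ²)‖φ‖² ≤ Re⟨φ, H(t,t',0)φ⟩`,
`Ô = dΓ_↑(S) - dΓ_↓(S) = Σ_x (-1)^{x₁+x₂}(n_{x↑} - n_{x↓})`. [cite: LiebLoss1993, §8, Theorem 8.2] -/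
theorem re_expect_hubbardTorusTT'_zero_ge_sdw (hL : 3 ≤ L) (hLe : Even L) (t : ℝ) {t' Δ : ℝ}
    (ht' : t' ≤ 0) (hΔ : Δ ≠ 0) (h4 : 4 * |t'| ≤ |Δ|) (hD : |Δ| * |t'| ≤ 2 * (t ^ 2 - t' ^ 2))
    (φ : Fock (Orb (FermionTorus 2 L))) :
    -Δ * (star φ ⬝ᵥ ((dGammaSpin 0 (stagMatrix 2 L) - dGammaSpin 1 (stagMatrix 2 L)) *ᵥ φ)).re +
        |Δ| * ((L : ℝ) ^ 2 * normSq φ - (star φ ⬝ᵥ (totalNumber *ᵥ φ)).re) -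
        (L : ℝ) ^ 2 * Real.sqrt (4 * t ^ 2 + Δ ^ 2) * normSq φ ≤
      (star φ ⬝ᵥ (hubbardTorusTT' L t t' 0 *ᵥ φ)).re := by
  -- the side conditions in terms of the diagonal hopping parameter `-t' ≥ 0`
  have hτ : 0 ≤ -t' := by linarith
  have habs : |t'| = -t' := abs_of_nonpos ht'
  have h2τ : 2 * (-t') ≤ |Δ| := by rw [← habs]; linarith [abs_nonneg t']
  have h4τ : 4 * |(-t')| ≤ |Δ| := by rwa [abs_neg]
  have hDτ : |Δ| * (-t') ≤ 2 * ((-t) ^ 2 - (-t') ^ 2) := by rw [neg_sq t, neg_sq t', ← habs]; exact hD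
  -- opaque names for the one-body matrices
  obtain ⟨K', hK'⟩ : ∃ K' : Matrix (FermionTorus 2 L) (FermionTorus 2 L) ℂ,
      K' = hopMatrix (fermionTorusDiagGraph L) (-t') := ⟨_, rfl⟩
  obtain ⟨E, hE⟩ : ∃ E : Matrix (FermionTorus 2 L) (FermionTorus 2 L) ℂ,
      E = sdwM 2 L (-t) Δ * sdwR 2 L (-t) Δ := ⟨_, rfl⟩
  obtain ⟨P, hP⟩ : ∃ P : ℝ → Matrix (FermionTorus 2 L) (FermionTorus 2 L) ℂ,
      ∀ s, P s = sdwProj 2 L (-t) Δ s := ⟨_, fun _ => rfl⟩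
  obtain ⟨c, hc⟩ : ∃ c : ℂ, c = ((|Δ| : ℝ) : ℂ) := ⟨_, rfl⟩
  -- one-body facts
  have hEP : ∀ s, E * P s = P s * E := fun s => by
    rw [hE, hP]; exact sdwE_matrix_mul_sdwProj hL hLe (-t) hΔ s
  have hK'P : ∀ s, K' * P s = P s * K' := fun s => by
    rw [hK', hP]; exact hopMatrix_diag_mul_sdwProj hL hLe (-t') (-t) Δ s
  have hPh : ∀ s, (P s)ᴴ = P s := fun s => by rw [hP]; exact conjTranspose_sdwProj hL hLe (-t) hΔ s
  have hPP : ∀ s : ℝ, s * s = 1 → P s * P s = P s := fun s hs => by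
    rw [hP]; exact sdwProj_mul_self hL hLe (-t) hΔ hs
  have hCpsd : (E + K').PosSemidef := by
    rw [hE, hK']; exact posSemidef_sdwE_add_diag hL (-t) (-t') hΔ h4τ
  have hBpsd : (E - K' - c • (1 : Matrix (FermionTorus 2 L) (FermionTorus 2 L) ℂ)).PosSemidef := by
    rw [hE, hK', hc]; exact posSemidef_sdwE_sub_diag_sub hL (-t) hΔ hτ h2τ hDτ
  have hdec : ∀ s, sdwH 2 L (-t) Δ s + K' = (E + K') * (1 - P s) - (E - K') * P s := fun s => by
    rw [hE, hK', hP]; exact sdwH_add_hopMatrix_diag_eq hL hLe (-t) (-t') hΔ s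
  -- per-spin bound
  have hspin : ∀ (σ : Fin 2) (s : ℝ), s * s = 1 →
      -(((E - K' - c • 1) * P s).trace.re * normSq φ) -
          |Δ| * (star φ ⬝ᵥ ((∑ x : FermionTorus 2 L, numberOp x σ) *ᵥ φ)).re ≤
        (star φ ⬝ᵥ (dGammaSpin σ (sdwH 2 L (-t) Δ s + K') *ᵥ φ)).re := by
    intro σ s hs
    have h1P : (1 - P s) * (1 - P s) = 1 - P s := by
      rw [Matrix.sub_mul, Matrix.one_mul, Matrix.mul_sub, Matrix.mul_one, hPP s hs]
      abel
    have h1h : (1 - P s)ᴴ = 1 - P s := by rw [conjTranspose_sub, conjTranspose_one, hPh]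
    -- `C = (E + K')(1 - P) = (1 - P)(E + K')(1 - P)ᴴ ⪰ 0`
    have hC : ((E + K') * (1 - P s)).PosSemidef := by
      have hcomm : (E + K') * (1 - P s) = (1 - P s) * (E + K') := by
        rw [Matrix.add_mul, Matrix.mul_add, Matrix.mul_sub, Matrix.mul_sub, Matrix.sub_mul, Matrix.sub_mul,
          Matrix.mul_one, Matrix.one_mul, Matrix.mul_one, Matrix.one_mul, hEP, hK'P]
      have key : (1 - P s) * (E + K') * (1 - P s)ᴴ = (E + K') * (1 - P s) := by
        rw [h1h, ← hcomm, Matrix.mul_assoc, h1P]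
      have h := hCpsd.mul_mul_conjTranspose_same (1 - P s)
      rw [key] at h
      exact h
    -- `(E - K' - |Δ|)P = P (E - K' - |Δ|) Pᴴ ⪰ 0`
    have hB : ((E - K' - c • 1) * P s).PosSemidef := by
      have hcomm : (E - K' - c • 1) * P s = P s * (E - K' - c • 1) := by
        rw [Matrix.sub_mul, Matrix.sub_mul, Matrix.mul_sub, Matrix.mul_sub, Matrix.smul_mul, Matrix.mul_smul,
          Matrix.one_mul, Matrix.mul_one, hEP, hK'P]
      have key : P s * (E - K' - c • 1) * (P s)ᴴ = (E - K' - c • 1) * P s := by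
        rw [hPh, ← hcomm, Matrix.mul_assoc, hPP s hs]
      have h := hBpsd.mul_mul_conjTranspose_same (P s)
      rw [key] at h
      exact h
    -- `1 - P ⪰ 0`
    have h1mP : (1 - P s).PosSemidef := by
      have h := posSemidef_self_mul_conjTranspose (1 - P s)
      rw [h1h, h1P] at h
      exact h
    -- `dΓ(h_s + K') = dΓ(C) - dΓ((E-K'-|Δ|)P) - |Δ| dΓ(P)`
    have hBsplit : (E - K') * P s = (E - K' - c • 1) * P s + c • P s := by
      rw [Matrix.sub_mul (E - K') (c • 1) (P s), Matrix.smul_mul, Matrix.one_mul, sub_add_cancel]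
    have hmat : sdwH 2 L (-t) Δ s + K' =
        (E + K') * (1 - P s) + (-1 : ℂ) • ((E - K' - c • 1) * P s) + (-c) • P s := by
      rw [hdec s, hBsplit, neg_smul, one_smul, neg_smul]
      abel
    have hsplit : dGammaSpin σ (sdwH 2 L (-t) Δ s + K') =
        dGammaSpin σ ((E + K') * (1 - P s)) - dGammaSpin σ ((E - K' - c • 1) * P s) -
          c • dGammaSpin σ (P s) := by
      rw [hmat, dGammaSpin_add, dGammaSpin_add, dGammaSpin_smul, dGammaSpin_smul, neg_smul, one_smul,
        neg_smul]
      abel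
    have e1 := re_expect_dGammaSpin_nonneg σ hC φ
    have e2 := re_expect_dGammaSpin_le_trace_mul_normSq σ hB φ
    -- (the generic lemma's `1` carries the `LinearOrder`-derived `DecidableEq`; `convert` bridges it)
    have h1mP' := h1mP
    have e3 := re_expect_dGammaSpin_le_number σ (P := P s)
      (by convert h1mP' using 4; congr 1; exact Subsingleton.elim _ _) φ
    have e3' := mul_le_mul_of_nonneg_left e3 (abs_nonneg Δ)
    have hexp : (star φ ⬝ᵥ (dGammaSpin σ (sdwH 2 L (-t) Δ s + K') *ᵥ φ)).re =
        (star φ ⬝ᵥ (dGammaSpin σ ((E + K') * (1 - P s)) *ᵥ φ)).re -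
          (star φ ⬝ᵥ (dGammaSpin σ ((E - K' - c • 1) * P s) *ᵥ φ)).re -
          |Δ| * (star φ ⬝ᵥ (dGammaSpin σ (P s) *ᵥ φ)).re := by
      rw [hsplit, Matrix.sub_mulVec, Matrix.sub_mulVec, dotProduct_sub, dotProduct_sub, Complex.sub_re,
        Complex.sub_re, Matrix.smul_mulVec, dotProduct_smul, smul_eq_mul, hc, Complex.re_ofReal_mul]
    rw [hexp]
    linarith [e1, e2, e3']
  -- traces of the two spins together
  have htrE1 : (E * (P 1 + P (-1))).trace = E.trace := by
    rw [hE, hP, hP]; exact trace_sdwE_matrix_mul_sdwProj_add hL (-t) hΔ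
  have htrK1 : (K' * (P 1 + P (-1))).trace = 0 := by
    rw [hK', hP, hP]; exact trace_diag_mul_sdwProj_add hL hLe (-t') (-t) hΔ
  have htrP : (P 1 + P (-1)).trace = (L : ℂ) ^ 2 := by
    rw [hP, hP, trace_add]; exact trace_sdwProj_add hL hLe (-t) hΔ
  have htr : ((E - K' - c • 1) * P 1).trace + ((E - K' - c • 1) * P (-1)).trace =
      E.trace - c * (L : ℂ) ^ 2 := by
    rw [← trace_add, ← Matrix.mul_add, Matrix.sub_mul, Matrix.sub_mul, trace_sub, trace_sub,
      Matrix.smul_mul, Matrix.one_mul, trace_smul, smul_eq_mul, htrE1, htrK1, htrP, sub_zero]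
  have htrE : E.trace.re ≤ (L : ℝ) ^ 2 * Real.sqrt (4 * t ^ 2 + Δ ^ 2) := by
    rw [hE, trace_sdwE_matrix hL (-t) hΔ, Complex.re_sum]
    simp only [Complex.ofReal_re]
    have h := sum_sdwE_le (L := L) hL (-t) Δ
    rwa [neg_sq] at h
  have htr_re : ((E - K' - c • 1) * P 1).trace.re + ((E - K' - c • 1) * P (-1)).trace.re =
      E.trace.re - |Δ| * (L : ℝ) ^ 2 := by
    rw [← Complex.add_re, htr, Complex.sub_re, hc]
    congr 1
    have : ((|Δ| : ℝ) : ℂ) * (L : ℂ) ^ 2 = (((|Δ| * (L : ℝ) ^ 2 : ℝ)) : ℂ) := by push_cast; ring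
    rw [this, Complex.ofReal_re]
  -- assemble
  have h0 := hspin 0 1 (by norm_num)
  have h1 := hspin 1 (-1) (by norm_num)
  have hsum := dGammaSpin_sdwH_add_diag_sum (L := L) t t' Δ
  rw [← hK'] at hsum
  have hN : (star φ ⬝ᵥ (totalNumber *ᵥ φ)).re =
      (star φ ⬝ᵥ ((∑ x : FermionTorus 2 L, numberOp x 0) *ᵥ φ)).re +
        (star φ ⬝ᵥ ((∑ x : FermionTorus 2 L, numberOp x 1) *ᵥ φ)).re := by
    rw [totalNumber_eq_add, Matrix.add_mulVec, dotProduct_add, Complex.add_re]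
  have hlhs : (star φ ⬝ᵥ (dGammaSpin 0 (sdwH 2 L (-t) Δ 1 + K') *ᵥ φ)).re +
      (star φ ⬝ᵥ (dGammaSpin 1 (sdwH 2 L (-t) Δ (-1) + K') *ᵥ φ)).re =
      (star φ ⬝ᵥ (hubbardTorusTT' L t t' 0 *ᵥ φ)).re +
        Δ * (star φ ⬝ᵥ ((dGammaSpin 0 (stagMatrix 2 L) - dGammaSpin 1 (stagMatrix 2 L)) *ᵥ φ)).re := by
    rw [← Complex.add_re, ← dotProduct_add, ← Matrix.add_mulVec, hsum, Matrix.add_mulVec, dotProduct_add,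
      Complex.add_re, Matrix.smul_mulVec, dotProduct_smul, smul_eq_mul, Complex.re_ofReal_mul]
  have hnn : 0 ≤ normSq φ := normSq_nonneg φ
  have htr_ns : ((E - K' - c • 1) * P 1).trace.re * normSq φ +
      ((E - K' - c • 1) * P (-1)).trace.re * normSq φ =
      E.trace.re * normSq φ - |Δ| * (L : ℝ) ^ 2 * normSq φ := by
    rw [← add_mul, htr_re, sub_mul]
  have hEns := mul_le_mul_of_nonneg_right htrE hnn
  rw [hN]
  linarith [h0, h1, hlhs, htr_ns, hEns]

/-- **The energy floor of the Néel mean-field class.** On `(ℤ/Lℤ)²`, `L ≥ 3` even, `t' ≤ 0`, `U ≥ 0`: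
a Fock vector `φ ≠ 0` with mean density `n` (`Re⟨N̂⟩ = nL²‖φ‖²`), staggered magnetisation `m`
(`Re⟨Ô⟩ = 2mL²‖φ‖²`, `Ô = Σ_x(-1)^{x₁+x₂}(n_{x↑} - n_{x↓})`) and at least the Hartree double occupancy
of its own Néel order (`Re⟨D̂⟩ ≥ (n²/4 - m²)L²‖φ‖²`; equality for every collinear two-sublattice
Hartree–Fock state, Wick's rule) has, for every `δ > 0` with `4|t'| ≤ δ`, `δ|t'| ≤ 2(t² - t'²)`,
`Re⟨φ, H(t,t',U)φ⟩ ≥ L²‖φ‖²(2δ|m| + δ(1 - n) - √(4t² + δ²) + U(n²/4 - m²))`.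
[cite: BachLiebSolovej1994, §2 eq. (2c.36)] -/
theorem re_expect_hubbardTorusTT'_ge_neelClass (hL : 3 ≤ L) (hLe : Even L) (t : ℝ) {t' U δ n m : ℝ}
    (ht' : t' ≤ 0) (hU : 0 ≤ U) (hδ : 0 < δ) (h4 : 4 * |t'| ≤ δ) (hD : δ * |t'| ≤ 2 * (t ^ 2 - t' ^ 2))
    (φ : Fock (Orb (FermionTorus 2 L)))
    (hN : (star φ ⬝ᵥ (totalNumber *ᵥ φ)).re = n * (L : ℝ) ^ 2 * normSq φ)
    (hO : (star φ ⬝ᵥ ((dGammaSpin 0 (stagMatrix 2 L) - dGammaSpin 1 (stagMatrix 2 L)) *ᵥ φ)).re =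
      2 * m * (L : ℝ) ^ 2 * normSq φ)
    (hDocc : (n ^ 2 / 4 - m ^ 2) * (L : ℝ) ^ 2 * normSq φ ≤
      (star φ ⬝ᵥ ((∑ x : FermionTorus 2 L, numberOp x 0 * numberOp x 1) *ᵥ φ)).re) :
    (L : ℝ) ^ 2 * normSq φ *
        (2 * δ * |m| + δ * (1 - n) - Real.sqrt (4 * t ^ 2 + δ ^ 2) + U * (n ^ 2 / 4 - m ^ 2)) ≤
      (star φ ⬝ᵥ (hubbardTorusTT' L t t' U *ᵥ φ)).re := by
  -- the field `Δ = -δ·sign(m)` (so that `-Δ·2m = 2δ|m|`)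
  have hU' : (star φ ⬝ᵥ (hubbardTorusTT' L t t' U *ᵥ φ)).re =
      (star φ ⬝ᵥ (hubbardTorusTT' L t t' 0 *ᵥ φ)).re +
        U * (star φ ⬝ᵥ ((∑ x : FermionTorus 2 L, numberOp x 0 * numberOp x 1) *ᵥ φ)).re := by
    rw [hubbardTorusTT'_eq_add_smul t t' 0 U, Matrix.add_mulVec, dotProduct_add, Complex.add_re,
      Matrix.smul_mulVec, dotProduct_smul, smul_eq_mul, Complex.re_ofReal_mul, sub_zero]
  have hnn : 0 ≤ normSq φ := normSq_nonneg φ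
  have hL2 : 0 ≤ (L : ℝ) ^ 2 * normSq φ := by positivity
  rcases le_or_gt 0 m with hm | hm
  · -- `m ≥ 0`: take `Δ = -δ`
    have hΔ : (-δ) ≠ 0 := by linarith
    have h4' : 4 * |t'| ≤ |(-δ)| := by rw [abs_neg, abs_of_pos hδ]; exact h4
    have hD' : |(-δ)| * |t'| ≤ 2 * (t ^ 2 - t' ^ 2) := by rw [abs_neg, abs_of_pos hδ]; exact hD
    have h := re_expect_hubbardTorusTT'_zero_ge_sdw hL hLe t ht' hΔ h4' hD' φ
    rw [abs_neg, abs_of_pos hδ, neg_sq, hO, hN] at h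
    rw [hU', abs_of_nonneg hm]
    nlinarith [mul_le_mul_of_nonneg_left hDocc hU]
  · -- `m < 0`: take `Δ = δ`
    have hΔ : δ ≠ 0 := hδ.ne'
    have h4' : 4 * |t'| ≤ |δ| := by rw [abs_of_pos hδ]; exact h4
    have hD' : |δ| * |t'| ≤ 2 * (t ^ 2 - t' ^ 2) := by rw [abs_of_pos hδ]; exact hD
    have h := re_expect_hubbardTorusTT'_zero_ge_sdw hL hLe t ht' hΔ h4' hD' φ
    rw [abs_of_pos hδ, hO, hN] at h
    rw [hU', abs_of_neg hm]
    nlinarith [mul_le_mul_of_nonneg_left hDocc hU]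

/-- **Per-site form.** Under the hypotheses of `re_expect_hubbardTorusTT'_ge_neelClass` and `φ ≠ 0`:
the energy per site `Re⟨φ, H(t,t',U)φ⟩ / (L²‖φ‖²)` of every state of the Néel mean-field class is at
least `2δ|m| + δ(1 - n) - √(4t² + δ²) + U(n²/4 - m²)`. [cite: BachLiebSolovej1994, §2 eq. (2c.36)] -/
theorem neelClass_energy_per_site_ge (hL : 3 ≤ L) (hLe : Even L) (t : ℝ) {t' U δ n m : ℝ}
    (ht' : t' ≤ 0) (hU : 0 ≤ U) (hδ : 0 < δ) (h4 : 4 * |t'| ≤ δ) (hD : δ * |t'| ≤ 2 * (t ^ 2 - t' ^ 2))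
    {φ : Fock (Orb (FermionTorus 2 L))} (hφ : φ ≠ 0)
    (hN : (star φ ⬝ᵥ (totalNumber *ᵥ φ)).re = n * (L : ℝ) ^ 2 * normSq φ)
    (hO : (star φ ⬝ᵥ ((dGammaSpin 0 (stagMatrix 2 L) - dGammaSpin 1 (stagMatrix 2 L)) *ᵥ φ)).re =
      2 * m * (L : ℝ) ^ 2 * normSq φ)
    (hDocc : (n ^ 2 / 4 - m ^ 2) * (L : ℝ) ^ 2 * normSq φ ≤
      (star φ ⬝ᵥ ((∑ x : FermionTorus 2 L, numberOp x 0 * numberOp x 1) *ᵥ φ)).re) :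
    2 * δ * |m| + δ * (1 - n) - Real.sqrt (4 * t ^ 2 + δ ^ 2) + U * (n ^ 2 / 4 - m ^ 2) ≤
      (star φ ⬝ᵥ (hubbardTorusTT' L t t' U *ᵥ φ)).re / ((L : ℝ) ^ 2 * normSq φ) := by
  have h := re_expect_hubbardTorusTT'_ge_neelClass hL hLe t ht' hU hδ h4 hD φ hN hO hDocc
  have hpos : 0 < normSq φ := by
    rcases (normSq_nonneg φ).lt_or_eq with hlt | heq
    · exact hlt
    · exact absurd (eq_zero_of_normSq_eq_zero heq.symm) hφ
  have hL0 : (0 : ℝ) < (L : ℝ) ^ 2 := by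
    have : (0 : ℝ) < L := by exact_mod_cast (lt_of_lt_of_le (by norm_num : 0 < 3) hL)
    positivity
  rw [le_div_iff₀ (mul_pos hL0 hpos)]
  linarith

end Main

end NeelClassFloor

end Summit.Ventures.CertifiedManyBodySolver.Observables

end
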